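import Summits.BirchSwinnertonDyer.BirchSwinnertonDyer.Theorems.ResidualThetaTransportAtTwoSignedMuSeedAtTwoPlusSmoothingCoboundaryTranslate
import Summits.BirchSwinnertonDyer.BirchSwinnertonDyer.Theorems.ResidualThetaTransportAtTwoSignedMuSeedAtTwoPlusSmoothingCoboundaryEngineTransfer
import HarnessLib

/-!
# Smoothing coboundary IX-LT — EXACT order transfer `ord (η·G∘s − G) = ord G` for `s ≡ T (mod T²)`, `η − 1` a unit, and
# the engine transfer (CS6) in the Lubin–Tate model: for ANY `a ≡ 1 (mod π)` the series `η·G∘[a]‾ − G` has the order of `G`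
# («`NonDeg(m; χ, 𝔩) = NonDeg(m; G_χ)` for `π_𝔩 ≡ 1 (mod 2)`, `η(π_𝔩) ≠ 1» — no precision condition is needed;
# stub CS6 of `Cruxes/SignedMuSeedAtTwoPlus/Lines/smoothing-coboundary.md`)
# (seed crux `SignedMuSeedAtTwoPlus` stmt-BirchSwinnertonDyer-21438; parent Kμ⁺ stmt-BirchSwinnertonDyer-20689, route
# ResidualThetaTransportAtTwo)

Cell `bsd-wall`, width seat `bsd-wall-rtt-p4-w2` g15 (`--supports`, closes nothing).  THEOREMS ONLY; BSD is not proved by this.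

* `twistSubst_zero` — `U 0 = 0`; **`order_twistSubst_eq`** — `ord (η·G∘s − G) = ord G` (triangularity `…Mahler.coeff_twistSubst` with the
  unit `η − 1` on the diagonal: the lowest coefficient of `G` survives); `nonDeg_twistSubst_iff'` — hence the engine's
  `(∃ a, ord S = a ∧ a + 2 < N)` transfers for EVERY threshold `N` (sharpens `…EngineTransfer.nonDeg_twistSubst_iff`, which asked `s ≡ t (mod tᴺ)`);
* `coeff_map_hom_one_add_pow_mul` — `[1 + πʲw]‾ ≡ t (mod t^{qʲ})`; `coeff_one_map_hom_of_mk_eq_one` — `a ≡ 1 (mod π) ⇒ [a]‾ ≡ t (mod t²)`;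
* **`order_classSeries_lubinTate_eq`**, **`nonDeg_classSeries_lubinTate_iff`** — for `a ≡ 1 (mod π)` and `η − 1` a unit of `A/π`:
  `ord (η·G∘[a]‾ − G) = ord G`, so non-degeneracy of `η·G∘[a]‾ − G` at any threshold is that of `G`.

[folklore]
-/

noncomputable section

set_option autoImplicit false
-- the Theorems namespace of this sub repeats the summit name by design (D-0017 nested layout)
set_option linter.dupNamespace false

open PowerSeries Finset
open Literature.NumberTheory.GaloisRepresentations

namespace Summit.BirchSwinnertonDyer.BirchSwinnertonDyer.Theorems.SignedMuAtTwo.SmoothingCoboundary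

section ExactOrder

variable {k : Type*} [CommRing k]

/-- `U 0 = 0` for the twisted substitution operator (`s = T·t`, `t(0) = 1`). [folklore] -/
theorem twistSubst_zero (η : k) {t : PowerSeries k} (ht : constantCoeff t = 1) :
    η • (0 : PowerSeries k).subst (X * t) - 0 = 0 := by
  ext n
  rw [coeff_twistSubst η ht, map_zero, mul_zero, zero_add,
    sum_eq_zero (fun d _ => by rw [map_zero, zero_mul]), mul_zero]

/-- **Exact order transfer**: for `η − 1` a unit and `s ≡ T (mod T²)` (`s(0) = 0`, `[T]s = 1`),
`ord (η·G∘s − G) = ord G` — the twisted substitution operator is triangular with a unit diagonal, so the lowest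
non-zero coefficient of `G` survives. [folklore] -/
theorem order_twistSubst_eq {η : k} (hη : IsUnit (η - 1)) {s : PowerSeries k} (hs0 : constantCoeff s = 0)
    (hs1 : coeff 1 s = 1) (G : PowerSeries k) :
    PowerSeries.order (η • G.subst s - G) = PowerSeries.order G := by
  obtain ⟨t, rfl, ht⟩ := exists_eq_X_mul hs0 hs1
  by_cases hG : G = 0
  · subst hG
    rw [twistSubst_zero η ht]
  · obtain ⟨n, hn⟩ : ∃ n : ℕ, (n : ℕ∞) = PowerSeries.order G :=
      ENat.ne_top_iff_exists.mp (by rwa [ne_eq, order_eq_top])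
    rw [← hn]
    have hG' := order_eq_nat.mp hn.symm
    refine order_eq_nat.mpr ⟨?_, fun i hi => ?_⟩
    · rw [coeff_twistSubst η ht, sum_eq_zero (fun d hd => by rw [hG'.2 d (mem_range.mp hd), zero_mul]),
        mul_zero, add_zero]
      exact fun h => hG'.1 ((hη.mul_right_eq_zero).mp h)
    · rw [coeff_twistSubst η ht, hG'.2 i hi, mul_zero, zero_add,
        sum_eq_zero (fun d hd => by rw [hG'.2 d (lt_trans (mem_range.mp hd) hi), zero_mul]), mul_zero]

/-- **`NonDeg` transfer at every threshold**: for `η − 1` a unit and `s ≡ T (mod T²)`,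
`(∃ a, ord (η·G∘s − G) = a ∧ a + 2 < N) ⟺ (∃ a, ord G = a ∧ a + 2 < N)`. [folklore] -/
theorem nonDeg_twistSubst_iff' {η : k} (hη : IsUnit (η - 1)) {s : PowerSeries k} (hs0 : constantCoeff s = 0)
    (hs1 : coeff 1 s = 1) (G : PowerSeries k) (N : ℕ) :
    (∃ a : ℕ, PowerSeries.order (η • G.subst s - G) = a ∧ a + 2 < N) ↔
      (∃ a : ℕ, PowerSeries.order G = a ∧ a + 2 < N) := by
  rw [order_twistSubst_eq hη hs0 hs1 G]

end ExactOrder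

section LubinTate

variable {A : Type*} [CommRing A] {π : A} {q : ℕ} (hA : LubinTate.IsLTRing π q) {f : PowerSeries A}
  (hf : LubinTate.IsLTSeries π q f)

/-- `[1 + πʲw]‾ ≡ t (mod t^{qʲ})` (`…Translate.coeff_map_hom_add_pow_mul` with `u = 1`, `[1] = t`). [folklore] -/
theorem coeff_map_hom_one_add_pow_mul (U : WeierstrassCurve A) (hU : U.formalGroupLaw = LubinTate.ltF hA hf)
    (j : ℕ) (w : A) :
    ∀ n < q ^ j, coeff n ((LubinTate.hom hA hf hf (1 + π ^ j * w)).map (Ideal.Quotient.mk (Ideal.span {π}))) =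
      coeff n (X : PowerSeries (A ⧸ Ideal.span {π})) := by
  intro n hn
  rw [coeff_map_hom_add_pow_mul hA hf U hU j 1 w n hn, LubinTate.hom_one, PowerSeries.map_X]

/-- `a ≡ 1 (mod π) ⇒ [T][a]‾ = 1` (`[a] ≡ aT (mod deg 2)`). [folklore] -/
theorem coeff_one_map_hom_of_mk_eq_one {a : A} (ha : Ideal.Quotient.mk (Ideal.span {π}) a = 1) :
    coeff 1 ((LubinTate.hom hA hf hf a).map (Ideal.Quotient.mk (Ideal.span {π}))) = 1 := by
  rw [PowerSeries.coeff_map, LubinTate.coeff_one_hom, ha]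

/-- **`ord (η·G∘[a]‾ − G) = ord G`** for every `a ≡ 1 (mod π)` and `η − 1` a unit of `A/π` (card: `π_𝔩 ≡ 1 (mod 2)` odd-prime
generator with `η(π_𝔩) ≠ 1`; `F°_{π_𝔩} = U_{π_𝔩} G_χ` has the order of `G_χ`). [folklore] -/
theorem order_classSeries_lubinTate_eq {a : A} (ha : Ideal.Quotient.mk (Ideal.span {π}) a = 1)
    {η : A ⧸ Ideal.span {π}} (hη : IsUnit (η - 1)) (G : PowerSeries (A ⧸ Ideal.span {π})) :
    PowerSeries.order (η • G.subst ((LubinTate.hom hA hf hf a).map (Ideal.Quotient.mk (Ideal.span {π}))) - G)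
      = PowerSeries.order G :=
  order_twistSubst_eq hη (constantCoeff_map_hom hA hf a) (coeff_one_map_hom_of_mk_eq_one hA hf ha) G

/-- **`NonDeg(m; χ, 𝔩) = NonDeg(m; G_χ)`** (CS6, Lubin–Tate form, every threshold): for `a ≡ 1 (mod π)` and `η − 1` a unit,
`(∃ b, ord (η·G∘[a]‾ − G) = b ∧ b + 2 < N) ⟺ (∃ b, ord G = b ∧ b + 2 < N)`. [folklore] -/
theorem nonDeg_classSeries_lubinTate_iff {a : A} (ha : Ideal.Quotient.mk (Ideal.span {π}) a = 1)
    {η : A ⧸ Ideal.span {π}} (hη : IsUnit (η - 1)) (G : PowerSeries (A ⧸ Ideal.span {π})) (N : ℕ) :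
    (∃ b : ℕ, PowerSeries.order
        (η • G.subst ((LubinTate.hom hA hf hf a).map (Ideal.Quotient.mk (Ideal.span {π}))) - G) = b ∧ b + 2 < N) ↔
      (∃ b : ℕ, PowerSeries.order G = b ∧ b + 2 < N) := by
  rw [order_classSeries_lubinTate_eq hA hf ha hη G]

/-- The element `1 + πʲ·w` (`j ≥ 1`) is `≡ 1 (mod π)`. [folklore] -/
theorem mk_one_add_pow_mul_eq_one {j : ℕ} (hj : 1 ≤ j) (w : A) :
    Ideal.Quotient.mk (Ideal.span {π}) (1 + π ^ j * w) = 1 := by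
  rw [map_add, map_one, add_eq_left, Ideal.Quotient.eq_zero_iff_mem]
  exact Ideal.mul_mem_right _ _ (Ideal.pow_mem_of_mem _ (Ideal.mem_span_singleton_self π) _ hj)

end LubinTate

end Summit.BirchSwinnertonDyer.BirchSwinnertonDyer.Theorems.SignedMuAtTwo.SmoothingCoboundary
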